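import Summits.BirchSwinnertonDyer.BirchSwinnertonDyer.Theorems.ByReductionTypeAtTwoSupersingularUniformFlatLineFineMu
import Literature.NumberTheory.EllipticCurves.Sprung2012.SharpFlatSelmerDualInvolutionTwistProofs
import Literature.NumberTheory.EllipticCurves.Kato2004.FineSelmerDualInvolutionInvariantsProofs
import Literature.NumberTheory.EllipticCurves.IwasawaAlgebraInvolutionFixedPrimesProofs
import HarnessLib

/-!
# Route `ByReductionTypeAtTwo` (rung K4), crux `SupersingularRankZeroAtTwo` (item stmt-BirchSwinnertonDyer-19097), line `odd_blind_package`: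
# **ROAD-CONTRA — the T-84 road (♭ upper divisibility at `2` + `MissingUpperBoundAt W 2`) RE-KEYED CONTRAGREDIENTLY**
# (v2.18 prerequisite (R1), tower-1 GEN 67 §4 / pen RC-800 (B); cell `bsd-2adic`, LEAD ss-1 GEN 25; `--supports 19097`, helper)

WHY.  Conjunct (8) of `stub_flatPackage` pins Kato's `𝐇¹ = I.H` (`I : IwasawaH1Data W 2 κ γ`, covariant: `1+T ↦ conj_γ`), Sprung's
`X♭ = D.X` and Kato's `X₀ = Y.X` (both: `1+T ↦` PRE-composition with `conj_γ`) over the SAME `γ` and asks for Λ-LINEAR maps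
`𝐇¹ →loc→ P →toX→ X♭ →δ→ X₀`.  The Kummer pairing is CONTRAGREDIENT (tower-1 GEN 67 ★ p830536 `SSFlatPackage.exists_flatLocalDualityHom`,
clause (T)), so the print Poitou–Tate map is Λ-linear into the key-`γ⁻¹` datum `X♭_std = D_{γ⁻¹}` and `ι`-semilinear into `D_γ = (X♭_std)^ι`
(`Sprung2012/SharpFlatSelmerDualInvolutionTwistProofs`, «Why»).  Repair (R1) of v2.18 re-keys the two DUAL data of (8) to `γ⁻¹` (and F4
becomes the print-exact `Kato2004.thm13_4_two_lengthAt_fineSelmerDualContra_le_of_isEulerSystemClassTwo`).  This file is the road behind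
that re-keying: the T-84 closer and consumer (`SSFlatRoad.flatUpper_two_of_flatColemanKato_of_fineMu` / `…missingUpperBoundAt_two_of_uniformFlat_of_fineMu`)
with the (8)-block RE-KEYED — `D`, `Y` over `γ⁻¹`, `I` over `γ`, maps `→ₗ[Λ]` — and NOTHING ELSE changed.  The module theory
(`Kato2004.mem_charIdeal_of_skeleton_integral`) is abstract; the keying enters through facts the LANDED dictionary carries BY NAME:
`X₀` torsion / f.g. / `μ(X₀) = 0` are keying-immune (`Kato2004.fineSelmerDualData_exists_involTwist` + uniqueness, `…_mu_inv_eq`), `X♭` f.g.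
likewise (`sharpFlatSelmerDualData_finite_inv_iff`), and `char D_γ = ι(char D_{γ⁻¹})` (`…_mem_charIdeal_iff_inv`) with `(ι ξ)(0) = ξ(0)`
(`IwasawaAlgebra.constantCoeff_invol`), so EC♭ (★ `SSFlatRoad.flatEulerChar_two`, key `γ`) reads the constant term of the key-`γ⁻¹` generator.

WHAT (theorems only; no definition, no named fact, no instance, no `sorry`; axioms the standard trio): §0 glue `invol_dvd_iff`,
`mem_span_invol_iff`, `fineSelmerDualData_isTorsion_inv` / `_finite_inv`, `sharpFlatSelmerDualData_charIdeal_eq_span_invol`; §1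
`flatUpper_two_of_flatColemanKato_of_fineMu_contra` (closer: for every key-`γ⁻¹` ♭ datum, `X♭_std` torsion, `char = (ξ)`, `ι₂(ξ·h) = C(ϖ)·ι₂ L♭`);
§2 `missingUpperBoundAt_two_of_flatUpper_contra` (door) and `missingUpperBoundAt_two_of_uniformFlat_of_fineMu_contra` (consumer).  Downstream
nothing else needs re-keying: `ξ(0)`, `ξ(−2)`, `(T+2) ∣ ξ`, `μ`, `λ` are `ι`-invariant (`0`, `−2` = the two fixed points of `ι` at `p = 2`).
HONEST FRAMING: helpers; close NO registered stub; 19097 OPEN on 5 registered stubs (v2.17); the crux, Conjecture A at `2`, BSD are NOT proved;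
BSD is proved for no curve.  References: [Kato2004Asterisque, Thm. 12.4, 12.5 (4), 13.4 (2), §17.13] [Sprung2012, Def. 7.11, Thm. 7.14, 7.16,
Prop. 7.19] [Greenberg1989, §0 pp. 101–102] [GreenbergLNM1716, §1 p. 60] [CoatesSujatha2005, §3 (A)] [Washington1997, §13.2].
-/

set_option autoImplicit false
set_option linter.dupNamespace false

noncomputable section

open scoped Classical MatrixGroups ModularForm NumberField
open NumberField IsDedekindDomain CongruenceSubgroup WeierstrassCurve Literature.NumberTheory.EllipticCurves
  Literature.NumberTheory.EllipticCurves.ModularForms Literature.NumberTheory.EllipticCurves.Sprung2017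
  Literature.NumberTheory.EllipticCurves.Sprung2012
  Literature.NumberTheory.EllipticCurves.Rank1Residual Literature.NumberTheory.EllipticCurves.Rank1Residual.Typed
  Literature.NumberTheory.EllipticCurves.Kobayashi2003 Literature.NumberTheory.EllipticCurves.IwasawaDual
  Literature.NumberTheory.EllipticCurves.IwasawaAlgebra
  Literature.NumberTheory.GaloisRepresentations
  ZpExtension Summit.BirchSwinnertonDyer.Rank1Residual Summit.BirchSwinnertonDyer.Rank1Residual.Supersingular
  Summit.BirchSwinnertonDyer.Rank1Residual.X5.O1

universe u

namespace Summit.BirchSwinnertonDyer.BirchSwinnertonDyer.Theorems.SSFlatRoad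

/-! ## §0 `ι`-glue: the Iwasawa involution `ι : T ↦ (1+T)⁻¹ − 1` and the `γ ↦ γ⁻¹` re-keying of the dual data -/

section Glue

variable {p : ℕ} [Fact p.Prime]

/-- `ι f ∣ g ↔ f ∣ ι g` in `Λ` (`ι` is an involutive ring automorphism). [cite: Washington1997, §13.2] -/
theorem invol_dvd_iff (f g : IwasawaAlgebra p) : invol p f ∣ g ↔ f ∣ invol p g := by
  refine ⟨fun ⟨q, hq⟩ ↦ ⟨invol p q, by rw [hq, map_mul, invol_invol]⟩, fun ⟨q, hq⟩ ↦ ⟨invol p q, ?_⟩⟩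
  rw [← invol_invol p g, hq, map_mul]

/-- `(ξ) = (η)`-transport of principal ideals along `ι`: `g ∈ span {ι f} ↔ ι g ∈ span {f}`. [cite: Washington1997, §13.2] -/
theorem mem_span_invol_iff (f g : IwasawaAlgebra p) :
    g ∈ Ideal.span {invol p f} ↔ invol p g ∈ Ideal.span {f} := by
  rw [Ideal.mem_span_singleton, Ideal.mem_span_singleton, invol_dvd_iff]

variable {K : Type u} [Field K] [NumberField K] (W : WeierstrassCurve K) (κ : ZpExtension K p)
  {γ : Field.absoluteGaloisGroup K}

/-- **`X₀` torsion is keying-immune**: for ANY fine dual datum `Y` of key `γ` and ANY `Y′` of key `γ⁻¹`, `Y.X` torsion ⟹ `Y′.X` torsion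
(`Y′ ≃ₗ Y^ι`: twist + uniqueness). [cite: Greenberg1989, §0 pp. 101–102] [cite: Washington1997, §13.2] -/
theorem fineSelmerDualData_isTorsion_inv (Y : W.FineSelmerDualData κ γ) (Y' : W.FineSelmerDualData κ γ⁻¹)
    (hY : Module.IsTorsion (IwasawaAlgebra p) Y.X) : Module.IsTorsion (IwasawaAlgebra p) Y'.X := by
  obtain ⟨Y₁, e, he, -⟩ := Kato2004.fineSelmerDualData_exists_involTwist (mul_inv_cancel γ) Y
  obtain ⟨e'⟩ := WeierstrassCurve.FineSelmerDualData.nonempty_linearEquiv Y' Y₁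
  have h₁ : Module.IsTorsion (IwasawaAlgebra p) Y₁.X := Kato2004.isTorsion_of_involSemilinear hY e he
  intro x
  obtain ⟨⟨a, ha⟩, hax⟩ := @h₁ (e' x)
  exact ⟨⟨a, ha⟩, e'.injective (by change e' (a • x) = e' 0; rw [map_smul, map_zero]; exact hax)⟩

/-- **`X₀` finitely generated is keying-immune** (same transport). [cite: Greenberg1989, §0 pp. 101–102] [cite: Washington1997, §13.2] -/
theorem fineSelmerDualData_finite_inv (Y : W.FineSelmerDualData κ γ) (Y' : W.FineSelmerDualData κ γ⁻¹)
    [Module.Finite (IwasawaAlgebra p) Y.X] : Module.Finite (IwasawaAlgebra p) Y'.X := by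
  obtain ⟨Y₁, e, he, -⟩ := Kato2004.fineSelmerDualData_exists_involTwist (mul_inv_cancel γ) Y
  obtain ⟨e'⟩ := WeierstrassCurve.FineSelmerDualData.nonempty_linearEquiv Y' Y₁
  haveI : Module.Finite (IwasawaAlgebra p) Y₁.X := Kato2004.finite_of_involSemilinear e he
  exact Module.Finite.equiv e'.symm

variable {E : Type u} [Field E] [Algebra K E] {ιE : AlgebraicClosure K →ₐ[K] AlgebraicClosure E} {ap : ℤ}
  {g : Field.absoluteGaloisGroup E} {c : ℕ → localPoints W E} {col : Chroma}

/-- **`char D_{γ⁻¹} = (ξ) ⟹ char D_γ = (ι ξ)`** for ANY ♭/♯ dual data `D` of key `γ` and `D′` of key `γ⁻¹` (the landed dictionary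
`sharpFlatSelmerDualData_mem_charIdeal_iff_inv`, read on a principal ideal). [cite: GreenbergLNM1716, §1 (p. 60)] [cite: Washington1997, §13.2] -/
theorem sharpFlatSelmerDualData_charIdeal_eq_span_invol (D : SharpFlatSelmerDualData W κ γ ιE ap g c col)
    (D' : SharpFlatSelmerDualData W κ γ⁻¹ ιE ap g c col) {f : IwasawaAlgebra p}
    (hf : D'.charIdeal = Ideal.span {f}) : D.charIdeal = Ideal.span {invol p f} := by
  ext x
  rw [sharpFlatSelmerDualData_mem_charIdeal_iff_inv D D' x, hf, mem_span_invol_iff]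

end Glue

/-! ## §1 The T-84 closer RE-KEYED: ♭ upper divisibility at `2` for the key-`γ⁻¹` (print) `X♭` -/

section AtTwo

variable (W : WeierstrassCurve ℚ) [W.IsElliptic] [W.IsGloballyMinimal]
  {κ : ZpExtension ℚ 2} {γ : Field.absoluteGaloisGroup ℚ}
  {E : Type} [Field E] [Algebra ℚ E] (ι : AlgebraicClosure ℚ →ₐ[ℚ] AlgebraicClosure E)
  (g : Field.absoluteGaloisGroup E) (c : ℕ → localPoints W E)

/-- **T-84 closer, contragredient keying (v2.18 R1).**  `SSFlatRoad.flatUpper_two_of_flatColemanKato_of_fineMu` with the package binder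
`hCK` RE-KEYED: the ♭ dual datum `D : SharpFlatSelmerDualData W κ γ⁻¹ …` and the fine dual witness `Y : W.FineSelmerDualData κ γ⁻¹` are
the CONTRAGREDIENT (print) modules, Kato's `I : IwasawaH1Data W 2 κ γ` stays covariant, the three maps stay `Λ`-linear; same conclusion for
the key-`γ⁻¹` `D`.  Proof = the T-84 proof over the abstract skeleton (`Kato2004.thm17_4_skeleton` / `mem_charIdeal_of_skeleton_integral`),
with `X₀` torsion / `μ(X₀) = 0` / finite generation transported from key `γ` by the dictionary.
[cite: Kato2004Asterisque, Thm. 12.4 (p. 221), Thm. 12.5 (4) (p. 222), Thm. 13.4 (2) (p. 226), §17.13]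
[cite: Sprung2012, Thm. 7.14, Thm. 7.16 and Prop. 7.19 (pp. 1504–1505)] [cite: CoatesSujatha2005, §3 statement (A)]
[cite: Greenberg1989, §0 pp. 101–102] -/
theorem flatUpper_two_of_flatColemanKato_of_fineMu_contra (h124 : Kato2004.thm12_4)
    (hX0 : Kato2004_fineSelmerDual_isTorsion)
    (hgood : W.HasGoodReductionAtPrime 2) (hss : (2 : ℤ) ∣ W.frobeniusTrace 2)
    (hL : W.entireLFunction 1 ≠ 0)
    (hκ : κ.IsCyclotomic) (hγ : κ.IsTopGenerator γ) (hγ' : IsCyclotomicVariable 2 γ)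
    (hfine : FineMuZeroAt W 2)
    (hCK : ∀ [NeZero (W.conductorNorm ℤ)] (f : CuspForm (Gamma0 (W.conductorNorm ℤ)) 2),
        IsNewformOf W f → ∀ (ϖ : ℚ), (ϖ : ℝ) * W.realPeriodRat = plusPeriod f →
      ∀ (Ls Lf : IwasawaAlgebra 2), IsSprungPair f 2 (W.frobeniusTrace 2) Ls Lf →
      ∀ (D : SharpFlatSelmerDualData W κ γ⁻¹ ι (W.frobeniusTrace 2) g c .flat)
        [ContinuousSMul ℤ_[2] (W.tateModule 2)],
        ∃ (I : Kato2004.IwasawaH1Data W 2 κ γ) (Y : W.FineSelmerDualData κ γ⁻¹)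
          (P : Submodule (IwasawaAlgebra 2) (IwasawaAlgebra 2))
          (loc : I.H →ₗ[IwasawaAlgebra 2] P) (toX : P →ₗ[IwasawaAlgebra 2] D.X)
          (δ : D.X →ₗ[IwasawaAlgebra 2] Y.X) (Z : Submodule (IwasawaAlgebra 2) I.H)
          (G : IwasawaAlgebra 2),
          Function.Exact loc toX ∧ Function.Exact toX δ ∧
          G ∈ Submodule.map (P.subtype ∘ₗ loc) Z ∧
          iwasawaToPowerSeries 2 G = PowerSeries.C (ϖ : ℚ_[2]) * iwasawaToPowerSeries 2 Lf ∧
          (∀ 𝔭 : PrimeSpectrum (IwasawaAlgebra 2), 𝔭.asIdeal.height = 1 →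
            PowerSeries.C (2 : ℤ_[2]) ∉ 𝔭.asIdeal →
            Literature.NumberTheory.EllipticCurves.Module.lengthAt (IwasawaAlgebra 2) Y.X 𝔭 ≤
              Literature.NumberTheory.EllipticCurves.Module.lengthAt (IwasawaAlgebra 2) (I.H ⧸ Z) 𝔭)) :
    ∀ [NeZero (W.conductorNorm ℤ)] (f : CuspForm (Gamma0 (W.conductorNorm ℤ)) 2),
        IsNewformOf W f → ∀ (ϖ : ℚ), (ϖ : ℝ) * W.realPeriodRat = plusPeriod f →
      ∀ (Ls Lf : IwasawaAlgebra 2), IsSprungPair f 2 (W.frobeniusTrace 2) Ls Lf →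
      ∀ (D : SharpFlatSelmerDualData W κ γ⁻¹ ι (W.frobeniusTrace 2) g c .flat),
        Module.IsTorsion (IwasawaAlgebra 2) D.X ∧
        ∃ g' h : IwasawaAlgebra 2, D.charIdeal = Ideal.span {g'} ∧
          iwasawaToPowerSeries 2 (g' * h) = PowerSeries.C (ϖ : ℚ_[2]) * iwasawaToPowerSeries 2 Lf := by
  intro _ f hf ϖ hϖ Ls Lf hSP D
  haveI : ContinuousSMul ℤ_[2] (W.tateModule 2) := TateModule.continuousSMul_padicInt
  obtain ⟨I, Y, P, loc, toX, δ, Z, G, hPX, hXY, hGZ, hιG, hESrat⟩ := hCK f hf ϖ hϖ Ls Lf hSP D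
  -- `X₀` torsion (Kato 12.4 fact, key `γ`) carried to the key-`γ⁻¹` witness `Y`
  set Y₀ : W.FineSelmerDualData κ γ := W.fineSelmerDualData κ hγ with hY₀_def
  have hY₀ : Module.IsTorsion (IwasawaAlgebra 2) Y₀.X := hX0 W 2 κ γ hκ hγ Y₀
  have hY : Module.IsTorsion (IwasawaAlgebra 2) Y.X := fineSelmerDualData_isTorsion_inv W κ Y₀ Y hY₀
  obtain ⟨htf, hrank⟩ := h124.isTorsionFree_and_rank_le_one W 2 hκ hγ I
  haveI := htf
  -- `G ≠ 0`: `ϖ ≠ 0` (else `Ω⁺_f = 0`, contradicting `L(E,1) = [0]⁺·Ω⁺_f ≠ 0`) and `L♭ ≠ 0`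
  have hLf : Lf ≠ 0 := flat_ne_zero_two W hf hgood hss hL hSP
  have hϖ0 : ϖ ≠ 0 := by
    intro h0
    apply hL
    rw [hf.entireLFunction_one_eq, ← hϖ, h0]
    simp
  have hG : G ≠ 0 := by
    intro h0
    rw [h0, map_zero] at hιG
    have h1 : PowerSeries.C (ϖ : ℚ_[2]) * iwasawaToPowerSeries 2 Lf ≠ 0 := by
      refine mul_ne_zero ?_ ?_
      · intro hC
        have := congrArg PowerSeries.constantCoeff hC
        simp only [PowerSeries.constantCoeff_C, map_zero] at this
        exact hϖ0 (by exact_mod_cast this)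
      · intro hz
        exact hLf ((iwasawaToPowerSeries_injective 2) (by rw [hz, map_zero]))
    exact h1 hιG.symm
  have hES : ∀ 𝔭 : PrimeSpectrum (IwasawaAlgebra 2), 𝔭.asIdeal.height = 1 →
      Literature.NumberTheory.EllipticCurves.Module.lengthAt (IwasawaAlgebra 2) Y.X 𝔭 ≤
        Literature.NumberTheory.EllipticCurves.Module.lengthAt (IwasawaAlgebra 2) (I.H ⧸ Z) 𝔭 := by
    intro 𝔭 h1
    by_cases h2 : PowerSeries.C (2 : ℤ_[2]) ∈ 𝔭.asIdeal
    · -- at the unique height-one prime `(2) ∋ 2` the clause is `μ(X₀) ≤ μ(𝐇¹/Z)`; `μ(X₀) = 0` (statement (A) at `(E,2)`, key `γ`,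
      -- keying-immune by `Kato2004.fineSelmerDualData_mu_inv_eq`) supplies it.
      haveI hY₀f : Module.Finite (IwasawaAlgebra 2) Y₀.X :=
        WeierstrassCurve.FineSelmerDualData.module_finite W κ hγ Y₀
      haveI hYf : Module.Finite (IwasawaAlgebra 2) Y.X := fineSelmerDualData_finite_inv W κ Y₀ Y
      have hμ₀ : muInvariant 2 Y₀.X = 0 := hfine κ γ hκ hγ hγ' Y₀ hY₀f hY₀
      have hμ : muInvariant 2 Y.X = 0 := by
        rw [Kato2004.fineSelmerDualData_mu_inv_eq Y₀ Y]; exact hμ₀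
      rw [lengthAt_eq_zero_of_muInvariant_eq_zero Y.X hY hμ 𝔭 h1 h2]
      exact zero_le
    · exact hESrat 𝔭 h1 h2
  -- `X♭_std` finitely generated: from the key-`γ` datum by the ♭ dictionary
  obtain ⟨D₀⟩ := nonempty_sharpFlatSelmerDualData W κ ι (W.frobeniusTrace 2) g c Chroma.flat hγ
  haveI : Module.Finite (IwasawaAlgebra 2) D₀.X := D₀.moduleFinite hγ
  haveI : Module.Finite (IwasawaAlgebra 2) D.X := (sharpFlatSelmerDualData_finite_inv_iff D₀ D).1 inferInstance
  obtain ⟨htors, hmem⟩ := Kato2004.mem_charIdeal_of_skeleton_integral 2 hrank loc toX δ hPX hXY P.subtype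
    P.injective_subtype hY Z hG hGZ hES
  refine ⟨htors, ?_⟩
  obtain ⟨g', hg⟩ := (charIdeal_isPrincipal_holds 2 D.X).principal
  have hg' : D.charIdeal = Ideal.span {g'} := hg
  have hmem' : G ∈ Ideal.span {g'} := by rw [← hg']; exact hmem
  obtain ⟨h, hh⟩ := Ideal.mem_span_singleton'.mp hmem'
  exact ⟨g', h, hg', by rw [mul_comm, hh]; exact hιG⟩

/-! ## §2 The door and the T-84 consumer, contragredient keying -/

/-- **The Kato half at `2` from the RE-KEYED road.**  PUB {modularity, GZK} + for the supplied data `(κ, γ, ι, g, c)`: the ♭ `Γ`-Euler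
characteristic at `2` for the key-`γ` data (`hEC`, what ★ `SSFlatRoad.flatEulerChar_two` delivers) and the ♭ upper divisibility for the
key-`γ⁻¹` data (`hup`, the §1 conclusion) ⟹ `MissingUpperBoundAt W 2`.  The proof of `missingUpperBoundAt_two_of_flatUpper` verbatim after
one transport: for the key-`γ` datum `D` and its key-`γ⁻¹` twist `D′` (`nonempty_sharpFlatSelmerDualData_of_mul_eq_one`), `char D′ = (ξ)`
gives `char D = (ι ξ)` (`sharpFlatSelmerDualData_charIdeal_eq_span_invol`), torsion transports (`…_isTorsion_inv_iff`), EC♭ reads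
`(ι ξ)(0) = ξ(0)` (`IwasawaAlgebra.constantCoeff_invol`); then `ξ(0)·h(0) = c♭·L(E,1)/Ω_E` as before.
[cite: Sprung2012, Thm. 7.14 and Thm. 7.16 (p. 1504)] [cite: Sprung2024, §5.2 Lemmas 5.5–5.9] [cite: Sprung2017, Cor. 4.4, Cor. 4.11]
[cite: Miller2011LMS, Def. 1.1] [cite: Greenberg1989, §0 pp. 101–102] -/
theorem missingUpperBoundAt_two_of_flatUpper_contra
    (hmod : nonempty_modularParametrizationData)
    (hGZK : rank_eq_analyticRank_of_analyticRank_le_one)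
    (hgood : W.HasGoodReductionAtPrime 2) (hss : (2 : ℤ) ∣ W.frobeniusTrace 2)
    (hL : W.entireLFunction 1 ≠ 0) (hγ : κ.IsTopGenerator γ)
    (hEC : ∀ (D : SharpFlatSelmerDualData W κ γ ι (W.frobeniusTrace 2) g c .flat)
        [Module.Finite (IwasawaAlgebra 2) D.X], Module.IsTorsion (IwasawaAlgebra 2) D.X →
      ∀ f : IwasawaAlgebra 2, D.charIdeal = Ideal.span {f} → Finite (W.selmerGroupPInfty 2) →
        ∃ u : ℤ_[2]ˣ, ((PowerSeries.constantCoeff f : ℤ_[2]) : ℚ_[2]) =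
          ((u : ℤ_[2]) : ℚ_[2]) * ((2 : ℕ) : ℚ_[2]) ^ (padicValNat 2 W.tamagawaProduct) *
            (Nat.card (W.selmerGroupPInfty 2) : ℚ_[2]))
    (hup : ∀ [NeZero (W.conductorNorm ℤ)] (f : CuspForm (Gamma0 (W.conductorNorm ℤ)) 2),
        IsNewformOf W f → ∀ (ϖ : ℚ), (ϖ : ℝ) * W.realPeriodRat = plusPeriod f →
      ∀ (Ls Lf : IwasawaAlgebra 2), IsSprungPair f 2 (W.frobeniusTrace 2) Ls Lf →
      ∀ (D : SharpFlatSelmerDualData W κ γ⁻¹ ι (W.frobeniusTrace 2) g c .flat),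
        Module.IsTorsion (IwasawaAlgebra 2) D.X ∧
        ∃ g' h : IwasawaAlgebra 2, D.charIdeal = Ideal.span {g'} ∧
          iwasawaToPowerSeries 2 (g' * h) = PowerSeries.C (ϖ : ℚ_[2]) * iwasawaToPowerSeries 2 Lf) :
    MissingUpperBoundAt W 2 := by
  have hr : W.analyticRank = 0 := analyticRank_eq_zero_of_entireLFunction_one_ne_zero W hL
  have hirr : W.HasIrreducibleModPGaloisRep 2 := P2.irr_two_of_goodSS_two W ⟨hgood, hss⟩
  -- modularity: the newform `f` of `E` and the (rational, positive) period ratio `ϖ`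
  haveI : NeZero (W.conductorNorm ℤ) := ⟨(W.conductorNorm_pos_holds).ne'⟩
  obtain ⟨Dm⟩ := hmod W
  set f := Dm.f with hf_def
  have hf : IsNewformOf W f := Dm.isNewformOf
  obtain ⟨ϖ, hϖpos, hϖeq, hΩpos⟩ := Dm.exists_rat_mul_realPeriodRat_eq_plusPeriod
  set s : ℚ := ratPlusSymbol f 0 with hs_def
  set t : ℚ := ϖ * s with ht_def
  have hLval : W.entireLFunction 1 = (((s : ℝ) * plusPeriod f : ℝ) : ℂ) := hf.entireLFunction_one_eq
  have ht : W.entireLFunction 1 / (W.realPeriodRat : ℂ) = ((t : ℚ) : ℂ) := by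
    rw [hLval, ← hϖeq, div_eq_iff (Complex.ofReal_ne_zero.mpr hΩpos.ne'), ht_def]
    push_cast
    ring
  have hs0 : s ≠ 0 := by
    intro h0
    apply hL
    rw [hLval, h0]
    simp
  have ht0 : t ≠ 0 := mul_ne_zero hϖpos.ne' hs0
  -- Sprung's pair at `2`; a key-`γ` dual datum `D` and a key-`γ⁻¹` one `D'`
  obtain ⟨Ls, Lf, hSP⟩ := exists_isSprungPair_two hf hgood hss
  obtain ⟨D⟩ := nonempty_sharpFlatSelmerDualData W κ ι (W.frobeniusTrace 2) g c Chroma.flat hγ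
  haveI : Module.Finite (IwasawaAlgebra 2) D.X := D.moduleFinite hγ
  obtain ⟨D'⟩ := nonempty_sharpFlatSelmerDualData_of_mul_eq_one (mul_inv_cancel γ) D
  obtain ⟨hTors', g', h, hchar', hgh⟩ := hup f hf ϖ hϖeq Ls Lf hSP D'
  have hTors : Module.IsTorsion (IwasawaAlgebra 2) D.X := (sharpFlatSelmerDualData_isTorsion_inv_iff D D').2 hTors'
  have hchar : D.charIdeal = Ideal.span {invol 2 g'} := sharpFlatSelmerDualData_charIdeal_eq_span_invol W κ D D' hchar'
  -- EC♭ at `2` for `ξ := ι g'`, whose constant term is that of `g'`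
  have hK : (⟨invol 2 g', 0, 0⟩ : SignedDatum W 2).EulerCharacteristic := fun hfin ↦
    hEC D hTors (invol 2 g') hchar hfin
  obtain ⟨hg0ne, hvg⟩ := valuation_constantCoeff_xi W 2 hGZK hL ⟨invol 2 g', 0, 0⟩ hK
  have hxi : (⟨invol 2 g', 0, 0⟩ : SignedDatum W 2).xi = invol 2 g' := rfl
  rw [hxi, constantCoeff_invol] at hg0ne hvg
  -- the `♭` constant at `2`: `L♭(0) = c♭·[0]⁺_f`, `c♭ = −a₂² + 2a₂ + 1` a `2`-adic unit
  set cf : ℚ := -(W.frobeniusTrace 2 : ℚ) ^ 2 + 2 * (W.frobeniusTrace 2) + 1 with hcf_def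
  have hLf0 := constantCoeff_flat_two_of_isSprungPair_of_isNewformOf hf hgood hSP
  have hcf1 : cf = 1 ∨ cf = -7 := by
    rcases frobeniusTrace_two_eq_zero_or W hgood hss with h | h | h
    · left; rw [hcf_def, h]; norm_num
    · left; rw [hcf_def, h]; norm_num
    · right; rw [hcf_def, h]; norm_num
  have hcfv : padicValRat 2 cf = 0 := by
    rcases hcf1 with h1 | h1 <;> rw [h1]
    · simp
    · rw [show (-7 : ℚ) = ((-7 : ℤ) : ℚ) by norm_num, padicValRat.of_int]
      norm_num [padicValInt, padicValNat.eq_zero_of_not_dvd]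
  have hcf0 : cf ≠ 0 := by rcases hcf1 with h1 | h1 <;> rw [h1] <;> norm_num
  have hϖLf : (ϖ : ℚ_[2]) * ((PowerSeries.constantCoeff Lf : ℤ_[2]) : ℚ_[2]) =
      (((cf * t : ℚ)) : ℚ_[2]) := by
    rw [hLf0, ht_def, hcf_def]
    push_cast
    ring
  -- the Kato side: `g'(0) · h(0) = ϖ · L♭(0) = c♭ · t`
  have hc := congrArg PowerSeries.constantCoeff hgh
  rw [constantCoeff_iwasawaToPowerSeries, map_mul, PadicInt.coe_mul, map_mul,
    PowerSeries.constantCoeff_C, constantCoeff_iwasawaToPowerSeries, hϖLf] at hc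
  have hctQ : (((cf * t : ℚ)) : ℚ_[2]) ≠ 0 := by exact_mod_cast mul_ne_zero hcf0 ht0
  have hh0 : ((PowerSeries.constantCoeff h : ℤ_[2]) : ℚ_[2]) ≠ 0 := fun h0 ↦
    hctQ (by rw [← hc, h0, mul_zero])
  have hval := congrArg Padic.valuation hc
  rw [Padic.valuation_mul hg0ne hh0, Padic.valuation_ratCast, hvg,
    padicValRat.mul hcf0 ht0, hcfv, zero_add] at hval
  have hhnn := valuation_coe_padicInt_nonneg _ hh0
  refine ⟨t * (W.torsionOrder : ℚ) ^ 2 / (W.tamagawaProduct : ℚ),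
    shaAn_eq_of_analyticRank_eq_zero W hGZK hr ht, ?_⟩
  rw [padicValRat_shaAn_witness W 2 hirr ht0]
  linarith

end AtTwo

/-- **T-84 consumer, contragredient keying (v2.18 R1).**  `SSFlatRoad.missingUpperBoundAt_two_of_uniformFlat_of_fineMu` with the (8)-block of
`hFlatAll` RE-KEYED (`D`, `Y` over `γ⁻¹`; `I` over `γ`; maps `Λ`-linear) and NOTHING else: EC♭ for the key-`γ` data by ★ `flatEulerChar_two`,
the upper divisibility for the key-`γ⁻¹` data by `flatUpper_two_of_flatColemanKato_of_fineMu_contra`, the door `missingUpperBoundAt_two_of_flatUpper_contra`.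
[cite: Kato2004Asterisque, Thm. 12.4, 12.5, 13.4 (2)] [cite: Sprung2012, Thm. 7.14, 7.16] [cite: CoatesSujatha2005, §3 statement (A)]
[cite: Greenberg1989, §0 pp. 101–102] -/
theorem missingUpperBoundAt_two_of_uniformFlat_of_fineMu_contra
    (hPub : nonempty_modularParametrizationData ∧ rank_eq_analyticRank_of_analyticRank_le_one)
    (h124 : Kato2004.thm12_4) (hX0 : Kato2004_fineSelmerDual_isTorsion)
    (hFlatAll :
      ∀ (W : WeierstrassCurve ℚ) [W.IsElliptic] [W.IsGloballyMinimal],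
      ¬ W.HasCM → W.analyticRank = 0 → GoodSS W 2 →
      ∀ (κ : ZpExtension ℚ 2) (γ : Field.absoluteGaloisGroup ℚ),
        κ.IsCyclotomic → κ.IsTopGenerator γ → IsCyclotomicVariable 2 γ →
      ∀ (v : HeightOneSpectrum (𝓞 ℚ)), (2 : 𝓞 ℚ) ∈ v.asIdeal →
      ∃ (g : Field.absoluteGaloisGroup (v.adicCompletion ℚ)) (c : ℕ → localPoints W (v.adicCompletion ℚ)),
        κ.IsTopGenerator (resGalOfEmb (closureEmb (K := ℚ) (v.adicCompletion ℚ)) g) ∧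
        (∀ n, c n ∈ localLayerPointsOfEmb κ (closureEmb (K := ℚ) (v.adicCompletion ℚ)) W n) ∧
        (∀ n, 1 ≤ n → localTraceOfEmb κ (closureEmb (K := ℚ) (v.adicCompletion ℚ)) W n (n + 1)
          (c (n + 1)) = W.frobeniusTrace 2 • c n - c (n - 1)) ∧
        (∀ z₀ : localLayerPointsOfEmb κ (closureEmb (K := ℚ) (v.adicCompletion ℚ)) W 0 →+ ℤ_[2],
          evalOn W (localLayerPointsOfEmb κ (closureEmb (K := ℚ) (v.adicCompletion ℚ)) W 0) z₀ (c 0) = 0 →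
            z₀ = 0) ∧
        (∀ a : ℤ_[2],
          (∃ z₀ : localLayerPointsOfEmb κ (closureEmb (K := ℚ) (v.adicCompletion ℚ)) W 0 →+ ℤ_[2],
            evalOn W (localLayerPointsOfEmb κ (closureEmb (K := ℚ) (v.adicCompletion ℚ)) W 0) z₀ (c 0) =
              2 * a) →
          ∃ y : localLayerPointsOfEmb κ (closureEmb (K := ℚ) (v.adicCompletion ℚ)) W 0 →+ ℤ_[2],
            evalOn W (localLayerPointsOfEmb κ (closureEmb (K := ℚ) (v.adicCompletion ℚ)) W 0) y (c 0) = a) ∧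
        (Finite (W.selmerGroupPInfty 2) →
          Finite (EndCoinvariants (conjSharpFlatSelmerInfty W κ (closureEmb (K := ℚ) (v.adicCompletion ℚ))
            (W.frobeniusTrace 2) g c .flat γ - 1)) →
          Nat.card (↥((sharpFlatSelmerInfty W κ (closureEmb (K := ℚ) (v.adicCompletion ℚ))
                (W.frobeniusTrace 2) g c .flat).comap (W.layerToInfty κ 0)) ⧸
              (W.selmerLayer κ 0).addSubgroupOf
                ((sharpFlatSelmerInfty W κ (closureEmb (K := ℚ) (v.adicCompletion ℚ))
                  (W.frobeniusTrace 2) g c .flat).comap (W.layerToInfty κ 0))) *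
            Nat.card (MulAction.fixedPoints (Field.absoluteGaloisGroup ℚ) (W.geomPrimaryTorsion 2)) =
          2 ^ (padicValNat 2 W.tamagawaProduct) *
            Nat.card (EndCoinvariants (conjSharpFlatSelmerInfty W κ
              (closureEmb (K := ℚ) (v.adicCompletion ℚ)) (W.frobeniusTrace 2) g c .flat γ - 1))) ∧
        (∀ [NeZero (W.conductorNorm ℤ)] (f : CuspForm (Gamma0 (W.conductorNorm ℤ)) 2),
            IsNewformOf W f → ∀ (ϖ : ℚ), (ϖ : ℝ) * W.realPeriodRat = plusPeriod f →
          ∀ (Ls Lf : IwasawaAlgebra 2), IsSprungPair f 2 (W.frobeniusTrace 2) Ls Lf →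
          ∀ (D : SharpFlatSelmerDualData W κ γ⁻¹ (closureEmb (K := ℚ) (v.adicCompletion ℚ))
              (W.frobeniusTrace 2) g c .flat) [ContinuousSMul ℤ_[2] (W.tateModule 2)],
            ∃ (I : Kato2004.IwasawaH1Data W 2 κ γ) (Y : W.FineSelmerDualData κ γ⁻¹)
              (P : Submodule (IwasawaAlgebra 2) (IwasawaAlgebra 2))
              (loc : I.H →ₗ[IwasawaAlgebra 2] P) (toX : P →ₗ[IwasawaAlgebra 2] D.X)
              (δ : D.X →ₗ[IwasawaAlgebra 2] Y.X) (Z : Submodule (IwasawaAlgebra 2) I.H)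
              (G : IwasawaAlgebra 2),
              Function.Exact loc toX ∧ Function.Exact toX δ ∧
              G ∈ Submodule.map (P.subtype ∘ₗ loc) Z ∧
              iwasawaToPowerSeries 2 G = PowerSeries.C (ϖ : ℚ_[2]) * iwasawaToPowerSeries 2 Lf ∧
              (∀ 𝔭 : PrimeSpectrum (IwasawaAlgebra 2), 𝔭.asIdeal.height = 1 →
                PowerSeries.C (2 : ℤ_[2]) ∉ 𝔭.asIdeal →
                Literature.NumberTheory.EllipticCurves.Module.lengthAt (IwasawaAlgebra 2) Y.X 𝔭 ≤
                  Literature.NumberTheory.EllipticCurves.Module.lengthAt (IwasawaAlgebra 2) (I.H ⧸ Z) 𝔭)))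
    (hFine : ∀ (W : WeierstrassCurve ℚ) [W.IsElliptic] [W.IsGloballyMinimal],
      ¬ W.HasCM → W.analyticRank = 0 → GoodSS W 2 → FineMuZeroAt W 2) :
    ∀ (W : WeierstrassCurve ℚ) [W.IsElliptic] [W.IsGloballyMinimal],
      ¬ W.HasCM → W.analyticRank = 0 → GoodSS W 2 → MissingUpperBoundAt W 2 := by
  intro W _ _ hcm hr hss
  have hL : W.entireLFunction 1 ≠ 0 :=
    Summit.BirchSwinnertonDyer.BirchSwinnertonDyer.Theorems.entireLFunction_one_ne_zero_of_analyticRank_eq_zero W hPub.1 hr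
  obtain ⟨κ, hκ, γ, hγ, hγ'⟩ := exists_isCyclotomic_isTopGenerator_isCyclotomicVariable_holds 2
  set v : HeightOneSpectrum (𝓞 ℚ) := (Rat.HeightOneSpectrum.primesEquiv (R := 𝓞 ℚ)).symm ⟨2, Nat.prime_two⟩
    with hv_def
  have hv : (2 : 𝓞 ℚ) ∈ v.asIdeal := by
    have h := natCast_mem_asIdeal_primesEquiv_symm 2 Nat.prime_two
    simpa [hv_def] using h
  obtain ⟨g, c, hg, hc, hTr, hinj, hsat, hcount, hCK⟩ := hFlatAll W hcm hr hss κ γ hκ hγ hγ' v hv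
  have hEC : ∀ (D : SharpFlatSelmerDualData W κ γ (closureEmb (K := ℚ) (v.adicCompletion ℚ))
      (W.frobeniusTrace 2) g c .flat) [Module.Finite (IwasawaAlgebra 2) D.X],
      Module.IsTorsion (IwasawaAlgebra 2) D.X →
      ∀ f : IwasawaAlgebra 2, D.charIdeal = Ideal.span {f} → Finite (W.selmerGroupPInfty 2) →
        ∃ u : ℤ_[2]ˣ, ((PowerSeries.constantCoeff f : ℤ_[2]) : ℚ_[2]) =
          ((u : ℤ_[2]) : ℚ_[2]) * ((2 : ℕ) : ℚ_[2]) ^ (padicValNat 2 W.tamagawaProduct) *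
            (Nat.card (W.selmerGroupPInfty 2) : ℚ_[2]) :=
    fun D _ hX f hf hfin ↦ flatEulerChar_two W hss κ hγ hv hg hc hTr hinj hsat hcount D hX f hf hfin
  exact missingUpperBoundAt_two_of_flatUpper_contra W _ g c hPub.1 hPub.2 hss.1 hss.2 hL hγ hEC
    (flatUpper_two_of_flatColemanKato_of_fineMu_contra W _ g c h124 hX0 hss.1 hss.2 hL hκ hγ hγ' (hFine W hcm hr hss) hCK)

end Summit.BirchSwinnertonDyer.BirchSwinnertonDyer.Theorems.SSFlatRoad

end
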